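import Mathlib
import Summits.Ventures.PercRepro2.Tail2D
import Summits.Ventures.PercRepro2.Tail2DSP
import Summits.Ventures.PercRepro2.Tail2DExchange
import Summits.Ventures.PercRepro2.Tail2DThreePoint
import Summits.Ventures.PercRepro2.Tail2DPairSign
import Summits.Ventures.PercRepro2.Tail2DFlowTwoLemmas

/-!
# The pairwise absorption lemmas at every vertical offset (seat mine-b, cell pub-perc-repro2)

For the `m2` defect of `T ⊛ N` (`crossB`, Tail2DPairSign.lean), the outer pair `{(2,k), (0,0)}` at red
distance two and its inner pair `{(1,k), (1,0)}` (the `e₁`-exchange) have a non-positive coefficient sum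
for every `k ≥ 1` (`abs2_E_gen`; `k = 0, -1` are `abs2_E0`, `abs2_Em1` of Tail2DFlowTwoLemmas.lean), and
likewise the `w`-exchange inner pair `{(1,k+1), (1,-1)}` for every `k ≤ -3` (`abs2_W_gen`; `k = -2` is
`abs2_Wm2`).  After the cancellation `B(v,u) = -B(u-e₁, v+e₁)` each sum is two balanced-pair brackets,
one signed by `dw_cone`, the other closed by the two-bracket lemma with a two-step `Δ₁`-chain
(`d1_cone` twice through `ratio_chain`) and a product of two `w`-exchanges — the general form of the
absorption program of conjectures/MINE-B.md §32.5/§32.7.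
-/

namespace Summit.Ventures.PercRepro2.Tail2D

namespace IsMTail

variable {T : ℤ → ℤ → ℝ} {L : ℤ} (hT : IsMTail T L)

include hT

/-- two `Δ₁`-exchanges in a row: `T(x)·T(y) ≤ T(x+2e₁)·T(y-2e₁)` when `y - x - 3e₁` lies in the cone `C₁`
(so that `Δ₁ log T` is non-increasing from `x` to `y - e₁` and from `x + e₁` to `y - 2e₁`) -/
lemma d1_two {x₁ x₂ y₁ y₂ : ℤ} (h1 : x₁ + 3 ≤ y₁) (h2 : x₁ + x₂ + 3 ≤ y₁ + y₂) :
    T x₁ x₂ * T y₁ y₂ ≤ T (x₁ + 2) x₂ * T (y₁ - 2) y₂ := by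
  have s1 := hT.d1_cone (a := x₁) (b := x₂) (a' := y₁ - 1) (b' := y₂) (by omega) (by omega)
  rw [show y₁ - 1 + 1 = y₁ by ring] at s1
  -- s1 : T y₁ y₂ * T x₁ x₂ ≤ T (x₁+1) x₂ * T (y₁-1) y₂
  have s2 := hT.d1_cone (a := x₁ + 1) (b := x₂) (a' := y₁ - 2) (b' := y₂) (by omega) (by omega)
  rw [show y₁ - 2 + 1 = y₁ - 1 by ring, show x₁ + 1 + 1 = x₁ + 2 by ring] at s2
  -- s2 : T (y₁-1) y₂ * T (x₁+1) x₂ ≤ T (x₁+2) x₂ * T (y₁-2) y₂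
  linarith [s1, s2, mul_comm (T y₁ y₂) (T x₁ x₂), mul_comm (T (y₁ - 1) y₂) (T (x₁ + 1) x₂)]

/-- **the `e₁`-absorption at every offset `k ≥ 1`**: the outer pair `{(2,k),(0,0)}` and its inner pair
`{(1,k),(1,0)}` (offsets from `z = (a,b)`) have a non-positive coefficient sum in the `m2` defect -/
theorem abs2_E_gen (a b : ℤ) {k : ℤ} (hk : 1 ≤ k) :
    crossB T (a - 2) (b - k) a b + crossB T a b (a - 2) (b - k)
      + crossB T (a - 1) (b - k) (a - 1) b + crossB T (a - 1) b (a - 1) (b - k) ≤ 0 := by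
  -- the signed bracket: T(a-1,b)·T(a+1,b-k-1) ≤ T(a,b-k)·T(a,b-1)  (w-exchange, displacement (1,-k) ∈ C_w)
  have hQ : T (a - 1) b * T (a + 1) (b - k - 1) ≤ T a (b - k) * T a (b - 1) := by
    have := hT.dw_cone (a := a - 1) (b := b) (a' := a) (b' := b - k) (by omega) (by omega)
    rw [show a - 1 + 1 = a by ring] at this
    linarith [this, mul_comm (T (a + 1) (b - k - 1)) (T (a - 1) b), mul_comm (T a (b - 1)) (T a (b - k))]
  -- c ≤ b : T(a-2,b-k)·T(a+2,b-1) ≤ T(a,b-k)·T(a,b-1)  (two Δ₁-steps)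
  have hcb : T (a - 2) (b - k) * T (a + 2) (b - 1) ≤ T a (b - k) * T a (b - 1) := by
    have := hT.d1_two (x₁ := a - 2) (x₂ := b - k) (y₁ := a + 2) (y₂ := b - 1) (by omega) (by omega)
    rw [show a - 2 + 2 = a by ring, show a + 2 - 2 = a by ring] at this
    exact this
  -- ac ≤ bd : the product of two w-exchanges
  have w1 : T (a + 2) (b - 1) * T (a - 1) b ≤ T a (b - 1) * T (a + 1) b := by
    have := hT.dw_cone (a := a - 1) (b := b) (a' := a + 1) (b' := b) (by omega) le_rfl
    rw [show a + 1 + 1 = a + 2 by ring, show a - 1 + 1 = a by ring] at this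
    exact this
  have w2 : T (a + 1) (b - k - 1) * T (a - 2) (b - k) ≤ T (a - 1) (b - k - 1) * T a (b - k) := by
    have := hT.dw_cone (a := a - 2) (b := b - k) (a' := a) (b' := b - k) (by omega) le_rfl
    rw [show a - 2 + 1 = a - 1 by ring] at this
    exact this
  have hprod := mul_le_mul w1 w2 (mul_nonneg (hT.nonneg _ _) (hT.nonneg _ _))
    (mul_nonneg (hT.nonneg _ _) (hT.nonneg _ _))
  have key := two_bracket (a := T (a - 1) b * T (a + 1) (b - k - 1)) (b := T a (b - k) * T a (b - 1))
    (c := T (a - 2) (b - k) * T (a + 2) (b - 1)) (d := T (a - 1) (b - k - 1) * T (a + 1) b)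
    (mul_nonneg (hT.nonneg _ _) (hT.nonneg _ _)) (mul_nonneg (hT.nonneg _ _) (hT.nonneg _ _))
    (mul_nonneg (hT.nonneg _ _) (hT.nonneg _ _)) hQ hcb (by nlinarith [hprod])
  unfold crossB
  ring_nf at key ⊢
  linarith [key]

/-- two `w`-exchanges in a row: `T(x)·T(y) ≤ T(x+2w)·T(y-2w)` when `y - x - 3w` lies in the cone `C_w` -/
lemma dw_two {x₁ x₂ y₁ y₂ : ℤ} (h1 : x₁ + 3 ≤ y₁) (h2 : y₂ + 3 ≤ x₂) :
    T x₁ x₂ * T y₁ y₂ ≤ T (x₁ + 2) (x₂ - 2) * T (y₁ - 2) (y₂ + 2) := by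
  have s1 := hT.dw_cone (a := x₁) (b := x₂) (a' := y₁ - 1) (b' := y₂ + 1) (by omega) (by omega)
  rw [show y₁ - 1 + 1 = y₁ by ring, show y₂ + 1 - 1 = y₂ by ring] at s1
  -- s1 : T y₁ y₂ * T x₁ x₂ ≤ T (x₁+1) (x₂-1) * T (y₁-1) (y₂+1)
  have s2 := hT.dw_cone (a := x₁ + 1) (b := x₂ - 1) (a' := y₁ - 2) (b' := y₂ + 2) (by omega) (by omega)
  rw [show y₁ - 2 + 1 = y₁ - 1 by ring, show y₂ + 2 - 1 = y₂ + 1 by ring, show x₁ + 1 + 1 = x₁ + 2 by ring,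
    show x₂ - 1 - 1 = x₂ - 2 by ring] at s2
  -- s2 : T (y₁-1) (y₂+1) * T (x₁+1) (x₂-1) ≤ T (x₁+2) (x₂-2) * T (y₁-2) (y₂+2)
  linarith [s1, s2, mul_comm (T y₁ y₂) (T x₁ x₂), mul_comm (T (y₁ - 1) (y₂ + 1)) (T (x₁ + 1) (x₂ - 1))]

/-- **the `w`-absorption at every offset `k = -m ≤ -3`**: the outer pair `{(2,-m),(0,0)}` and its inner
pair `{(1,1-m),(1,-1)}` (offsets from `z = (a,b)`) have a non-positive coefficient sum in the `m2` defect -/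
theorem abs2_W_gen (a b : ℤ) {m : ℤ} (hm : 3 ≤ m) :
    crossB T (a - 2) (b + m) a b + crossB T a b (a - 2) (b + m)
      + crossB T (a - 1) (b + m - 1) (a - 1) (b + 1) + crossB T (a - 1) (b + 1) (a - 1) (b + m - 1) ≤ 0 := by
  -- the signed bracket: T(a-1,b+1)·T(a+1,b+m-2) ≤ T(a,b+m-2)·T(a,b+1)  (e₁-exchange, displacement (1,m-3) ∈ C₁)
  have hQ : T (a - 1) (b + 1) * T (a + 1) (b + m - 2) ≤ T a (b + m - 2) * T a (b + 1) := by
    have := hT.d1_cone (a := a - 1) (b := b + 1) (a' := a) (b' := b + m - 2) (by omega) (by omega)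
    rw [show a - 1 + 1 = a by ring] at this
    linarith [this, mul_comm (T (a + 1) (b + m - 2)) (T (a - 1) (b + 1)), mul_comm (T a (b + 1)) (T a (b + m - 2))]
  -- c ≤ b : T(a-2,b+m)·T(a+2,b-1) ≤ T(a,b+m-2)·T(a,b+1)  (two w-steps)
  have hcb : T (a - 2) (b + m) * T (a + 2) (b - 1) ≤ T a (b + m - 2) * T a (b + 1) := by
    have := hT.dw_two (x₁ := a - 2) (x₂ := b + m) (y₁ := a + 2) (y₂ := b - 1) (by omega) (by omega)
    rw [show a - 2 + 2 = a by ring, show a + 2 - 2 = a by ring, show b - 1 + 2 = b + 1 by ring] at this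
    exact this
  -- ac ≤ bd : the product of two e₁-exchanges
  have e1 : T (a + 2) (b - 1) * T (a - 1) (b + 1) ≤ T a (b + 1) * T (a + 1) (b - 1) := by
    have := hT.d1_cone (a := a - 1) (b := b + 1) (a' := a + 1) (b' := b - 1) (by omega) (by omega)
    rw [show a + 1 + 1 = a + 2 by ring, show a - 1 + 1 = a by ring] at this
    exact this
  have e2 : T (a + 1) (b + m - 2) * T (a - 2) (b + m) ≤ T (a - 1) (b + m) * T a (b + m - 2) := by
    have := hT.d1_cone (a := a - 2) (b := b + m) (a' := a) (b' := b + m - 2) (by omega) (by omega)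
    rw [show a - 2 + 1 = a - 1 by ring] at this
    exact this
  have hprod := mul_le_mul e1 e2 (mul_nonneg (hT.nonneg _ _) (hT.nonneg _ _))
    (mul_nonneg (hT.nonneg _ _) (hT.nonneg _ _))
  have key := two_bracket (a := T (a - 1) (b + 1) * T (a + 1) (b + m - 2)) (b := T a (b + m - 2) * T a (b + 1))
    (c := T (a - 2) (b + m) * T (a + 2) (b - 1)) (d := T (a - 1) (b + m) * T (a + 1) (b - 1))
    (mul_nonneg (hT.nonneg _ _) (hT.nonneg _ _)) (mul_nonneg (hT.nonneg _ _) (hT.nonneg _ _))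
    (mul_nonneg (hT.nonneg _ _) (hT.nonneg _ _)) hQ hcb (by nlinarith [hprod])
  unfold crossB
  ring_nf at key ⊢
  linarith [key]

end IsMTail

end Summit.Ventures.PercRepro2.Tail2D
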